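import Summits.BirchSwinnertonDyer.BirchSwinnertonDyer.Theorems.CyclotomicUntwistPSTamagawaThreeTransport
import Summits.BirchSwinnertonDyer.BirchSwinnertonDyer.Theorems.CyclotomicUntwistPSKodairaDictionary
import HarnessLib

/-!
# LAW L-c3 (kernel): the Tamagawa factor at `3` on the cyclic wild rows of route `CyclotomicUntwist`
# is decided by the residue of `c₆` — `c₃ = 3 ⟺ c₆/3⁵ ≡ 1 (mod 3)` on Kodaira-`IV` rows with
# `v₃(Δ_min) = 6`, `c₃ = 3 ⟺ (Δ_min/3¹⁰)·(c₆/3⁶) ≡ 1 (mod 3)` on Kodaira-`IV*` rows with `v₃(Δ_min) = 10`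

Cell `pub/bsd-wall` (D-0145 line `route-BirchSwinnertonDyer-CyclotomicUntwist`), seat `bsd-line-cycu-p2`
(prover seat 2/3, gen 3), helper toward the cruxes K1 `PSRankOneLowerHalfAtThree`
(stmt-BirchSwinnertonDyer-21580; the binder `¬ 3 ∣ W.tamagawaProduct` of the registered stub
`stub_rung_lowerHalfOnGNine_towerUnit`) and K2 `PSRankOneUpperHalfAtThree` (stmt-21581; "why it might
fail: `c₃ = 3` occurs on IV/IV* rows"). THEOREMS ONLY (no definition, no named fact, no `sorry`); BSD
is not proved by this file and no crux is. The `ℚ`-level census law **L-c3** of the crux memo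
`Cruxes/PSRankOneUpperHalfAtThree/K2-TAMAGAWA-AT-3-v1.md` (cycu-p4 g2: 5 592 / 5 592 curves, a
THEOREM-CANDIDATE there) as a theorem `∀ W`, over the local kernel `…PSTamagawaThreeNormalForm.lean`
(p599771) and the transport layer `…PSTamagawaThreeTransport.lean` (this seat).

Notation: `W/ℚ` elliptic, globally minimal; `W_ℤ := integralModelInt W`, `c₆ := W_ℤ.c₆ ∈ ℤ`,
`Δ_min := W.minimalDiscriminantInt`, `v := v₃(Δ_min)`, `K₃ := W.kodairaSymbolAt (placeOf 3)`,
`c₃ := (W ⊗ ℚ₃).localTamagawaNumber ℤ₃` (the census / `PSKodairaDictionary` currency).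

* §4 **`localTamagawaNumber_three_eq_three_iff_of_kodairaIV`**: `K₃ = IV → v = 6 →
  (c₃ = 3 ↔ c₆ / 3⁵ % 3 = 1)`, with **`padicValInt_c₆_eq_five_of_kodairaIV`** (`v₃ c₆ = 5`, the Kraus
  signature `(3, 5, 6)`); **`localTamagawaNumber_three_eq_three_iff_of_kodairaIVstar`**:
  `K₃ = IV* → v = 10 → (c₃ = 3 ↔ (Δ_min / 3¹⁰) * (c₆ / 3⁶) % 3 = 1)`, with `v₃ c₆ = 6` (signature
  `(4, 6, 10)`); both through the local alternatives `…_iff_local_IV(star)` on the Tate model.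
* §5 the route's rows (`ClassO6 W 3` with `PSKodairaDictionary`: `4 ∣ v ⟹ c₃ = 1`, `v ≡ 2 (4) ⟹ IV ∧ v = 6`
  or `IV* ∧ v = 10`): `…_iff_of_six`, `…_iff_of_ten`, and on the PRINCIPAL-SERIES rows of K1/K2
  (`v` even, `Δ_min/3^v ≡ 1 (mod 3)`) **`three_dvd_localTamagawaNumber_three_iff_of_psRow`**:
  `3 ∣ c₃ ⟺ v % 4 = 2 ∧ c₆ / 3^{v₃ c₆} % 3 = 1` — the `ℓ = 3` factor of the K1-stub-2 predicate
  `3 ∣ ∏ c_ℓ` (`PSTamagawaProduct.three_dvd_tamagawaProduct_iff_of_even`) in Kraus-invariant,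
  census-decidable currency.

References: J. H. Silverman, *Advanced Topics in the Arithmetic of Elliptic Curves*, GTM 151 (1994),
IV.9.4 Steps 5, 8 (PDF pp. 344, 346), Rem. IV.9.3 [SilvermanATAEC1994]; *The Arithmetic of Elliptic
Curves*, 2nd ed. (2009), VII.1 Prop. 1.3(b) [SilvermanAEC2009]; I. Papadopoulos, J. Number Theory 44
(1993), Table (p = 3) [Papadopoulos1993]; A. Kraus, Manuscripta Math. 69 (1990) [Kraus1990].
-/

open scoped Classical

open IsLocalRing IsDedekindDomain WeierstrassCurve Rat.HeightOneSpectrum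
  Literature.NumberTheory.EllipticCurves Literature.NumberTheory.EllipticCurves.Rank1Residual
  Literature.NumberTheory.DiophantineGeometry Summit.BirchSwinnertonDyer.Rank1Residual.Additive

-- single-conjunct summit: `Summit.BirchSwinnertonDyer.BirchSwinnertonDyer.…` repeats the name by design
set_option linter.dupNamespace false
set_option autoImplicit false

namespace Summit.BirchSwinnertonDyer.BirchSwinnertonDyer.Theorems.PSTamagawaThree

/-! ### §4 LAW L-c3 over `ℚ`: the Tamagawa factor at `3` from the residue of `c₆` -/

section Law

variable (W : WeierstrassCurve ℚ) [W.IsElliptic] [W.IsGloballyMinimal]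

/-- `ord₃ Δ(I) = v₃(Δ_min)` for the Tate model `I` at `(3)` (the tree's `ordMinimalDiscriminant_placeOf_eq`,
with `Δ(I) ≠ 0`). [cite: SilvermanAEC2009, VIII.8 (minimal discriminant)] -/
theorem addVal_localMinimalIntegralModel_Δ :
    IsDiscreteValuationRing.addVal ((placeOf 3).adicCompletionIntegers ℚ)
        (W.localMinimalIntegralModel (placeOf 3)).Δ =
      (padicValInt 3 W.minimalDiscriminantInt : ℕ) := by
  have h := ordMinimalDiscriminant_placeOf_eq W 3
  unfold WeierstrassCurve.ordMinimalDiscriminant at h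
  have hne : IsDiscreteValuationRing.addVal ((placeOf 3).adicCompletionIntegers ℚ)
      (W.localMinimalIntegralModel (placeOf 3)).Δ ≠ ⊤ := by
    rw [Ne, IsDiscreteValuationRing.addVal_eq_top_iff]
    exact localMinimalIntegralModel_Δ_ne_zero (placeOf 3) W
  rw [← h, ENat.coe_toNat hne]

/-- `3ᵏ ∣ Δ(I) ⟺ k ≤ v₃(Δ_min)` for the Tate model `I` at `(3)`. [folklore] -/
theorem three_pow_dvd_localMinimalIntegralModel_Δ_iff (k : ℕ) :
    (3 : (placeOf 3).adicCompletionIntegers ℚ) ^ k ∣ (W.localMinimalIntegralModel (placeOf 3)).Δ ↔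
      k ≤ padicValInt 3 W.minimalDiscriminantInt := by
  rw [three_pow_dvd_iff_le_addVal isUnit_two_and_irreducible_three_placeOf_three.2,
    addVal_localMinimalIntegralModel_Δ, Nat.cast_le]

/-- `v₃ n = k` from `n = 3ᵏ·m` with `3 ∤ m`. [folklore] -/
theorem padicValInt_three_eq_of_eq_pow_mul {n m : ℤ} (k : ℕ) (h : n = 3 ^ k * m)
    (hm : ¬ (3 : ℤ) ∣ m) : padicValInt 3 n = k := by
  have hn : n ≠ 0 := by
    rintro rfl
    rcases mul_eq_zero.mp h.symm with h0 | h0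
    · exact absurd h0 (pow_ne_zero k (by norm_num))
    · exact hm (h0 ▸ dvd_zero 3)
  refine le_antisymm ?_ ?_
  · by_contra hlt
    have hk : ((3 : ℕ) : ℤ) ^ (k + 1) ∣ n := (padicValInt_dvd_iff (k + 1) n).mpr (Or.inr (by omega))
    rw [h, Nat.cast_ofNat, pow_succ] at hk
    exact hm ((mul_dvd_mul_iff_left (pow_ne_zero k (by norm_num))).mp hk)
  · have hk : ((3 : ℕ) : ℤ) ^ k ∣ n := ⟨m, by rw [h, Nat.cast_ofNat]⟩
    rcases (padicValInt_dvd_iff k n).mp hk with h0 | hle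
    · exact absurd h0 hn
    · exact hle

/-- The local alternative on the Tate model, type `IV` (`c_v = 3 ⟺ c₆(I) = 3⁵κ`, `κ̄ = 1`), at the place
`(3)` of `ℚ` and in the `ℤ₃`-currency of the census. [cite: SilvermanATAEC1994, IV.9.4 Step 5 with Rem. IV.9.3] -/
theorem localTamagawaNumber_three_eq_three_iff_local_IV (hK : W.kodairaSymbolAt (placeOf 3) = .IV)
    (hv : padicValInt 3 W.minimalDiscriminantInt = 6) :
    (W.baseChange ℚ_[3]).localTamagawaNumber ℤ_[3] = 3 ↔
      ∃ κ : (placeOf 3).adicCompletionIntegers ℚ, (W.localMinimalIntegralModel (placeOf 3)).c₆ = 3 ^ 5 * κ ∧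
        residue ((placeOf 3).adicCompletionIntegers ℚ) κ = 1 := by
  obtain ⟨h2, h3⟩ := isUnit_two_and_irreducible_three_placeOf_three
  haveI : PerfectField (ResidueField ((placeOf 3).adicCompletionIntegers ℚ)) := PerfectField.ofFinite
  haveI : HenselianLocalRing ((placeOf 3).adicCompletionIntegers ℚ) := inferInstance
  have hI : (W.localMinimalIntegralModel (placeOf 3)).kodairaSymbolOfMinimal = .IV := by
    rw [← kodairaSymbolAt_def]; exact hK
  have hΔ : (W.localMinimalIntegralModel (placeOf 3)).Δ ≠ 0 :=
    localMinimalIntegralModel_Δ_ne_zero (placeOf 3) W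
  have h6 : (3 : (placeOf 3).adicCompletionIntegers ℚ) ^ 6 ∣ (W.localMinimalIntegralModel (placeOf 3)).Δ :=
    (three_pow_dvd_localMinimalIntegralModel_Δ_iff W 6).mpr hv.ge
  rw [localTamagawaNumber_padic_eq_placeOf W 3]
  have key : ∀ (M : WeierstrassCurve ((placeOf 3).adicCompletion ℚ))
      [M.IsMinimal ((placeOf 3).adicCompletionIntegers ℚ)],
      (M.integralModel ((placeOf 3).adicCompletionIntegers ℚ)).kodairaSymbolOfMinimal = .IV →
      (3 : (placeOf 3).adicCompletionIntegers ℚ) ^ 6 ∣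
        (M.integralModel ((placeOf 3).adicCompletionIntegers ℚ)).Δ →
      (M.integralModel ((placeOf 3).adicCompletionIntegers ℚ)).Δ ≠ 0 →
      ((M.goodReductionSubgroup ((placeOf 3).adicCompletionIntegers ℚ)).index = 3 ↔
        ∃ κ : (placeOf 3).adicCompletionIntegers ℚ,
          (M.integralModel ((placeOf 3).adicCompletionIntegers ℚ)).c₆ = 3 ^ 5 * κ ∧
            residue ((placeOf 3).adicCompletionIntegers ℚ) κ = 1) := by
    intro M _ hM h6M hΔM
    obtain ⟨I, rfl⟩ : ∃ I : WeierstrassCurve ((placeOf 3).adicCompletionIntegers ℚ),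
        M = I.baseChange ((placeOf 3).adicCompletion ℚ) := WeierstrassCurve.IsIntegral.integral
    rw [integralModel_baseChange_eq] at hM h6M hΔM ⊢
    rw [goodReductionSubgroup_baseChange_eq]
    exact index_eq_three_iff_of_kodairaSymbolOfMinimal_eq_IV h3 h2 residueField_sq_eq_one_placeOf_three
      I hM h6M hΔM
  exact key (W.localMinimalModel (placeOf 3)) hI h6 hΔ

/-- **LAW L-c3, type `IV`.** For `W/ℚ` globally minimal of Kodaira type `IV` at `3` with `v₃(Δ_min) = 6`
(the `η`-order-`6` principal-series / cyclic rows of route `CyclotomicUntwist` with `v = 6`):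
**`c₃ = 3 ⟺ c₆(W_ℤ) / 3⁵ ≡ 1 (mod 3)`** (and otherwise `c₃ = 1`, `PSKodairaDictionary`).
[cite: SilvermanATAEC1994, IV.9.4 Step 5 (PDF p. 344) with Rem. IV.9.3] [cite: Papadopoulos1993, Table (p = 3)] -/
theorem localTamagawaNumber_three_eq_three_iff_of_kodairaIV (hK : W.kodairaSymbolAt (placeOf 3) = .IV)
    (hv : padicValInt 3 W.minimalDiscriminantInt = 6) :
    (W.baseChange ℚ_[3]).localTamagawaNumber ℤ_[3] = 3 ↔ (integralModelInt W).c₆ / 3 ^ 5 % 3 = 1 := by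
  obtain ⟨-, h3⟩ := isUnit_two_and_irreducible_three_placeOf_three
  have h3p : Prime (3 : (placeOf 3).adicCompletionIntegers ℚ) := h3.prime
  haveI : PerfectField (ResidueField ((placeOf 3).adicCompletionIntegers ℚ)) := PerfectField.ofFinite
  have hI : (W.localMinimalIntegralModel (placeOf 3)).kodairaSymbolOfMinimal = .IV := by
    rw [← kodairaSymbolAt_def]; exact hK
  have h6 : (3 : (placeOf 3).adicCompletionIntegers ℚ) ^ 6 ∣ (W.localMinimalIntegralModel (placeOf 3)).Δ :=
    (three_pow_dvd_localMinimalIntegralModel_Δ_iff W 6).mpr hv.ge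
  rw [localTamagawaNumber_three_eq_three_iff_local_IV W hK hv]
  obtain ⟨κ₀, hκ₀, hκ₀3⟩ := exists_c₆_eq_pow_five_mul_of_kodairaSymbolOfMinimal_eq_IV h3 _ hI h6
  obtain ⟨a, ha, hc₆, -⟩ := exists_isUnit_c₆_Δ_eq_mul_localMinimalIntegralModel W
  have hn : (((integralModelInt W).c₆ : ℤ) : (placeOf 3).adicCompletionIntegers ℚ) =
      3 ^ 5 * (a ^ 6 * κ₀) := by
    rw [hc₆, hκ₀]; ring
  obtain ⟨m, hm⟩ : (3 : ℤ) ^ 5 ∣ (integralModelInt W).c₆ := (three_pow_dvd_intCast_iff 5 _).mp ⟨_, hn⟩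
  have hdiv : (integralModelInt W).c₆ / 3 ^ 5 = m := by
    rw [hm, Int.mul_ediv_cancel_left _ (pow_ne_zero 5 (by norm_num))]
  have hmO : ((m : ℤ) : (placeOf 3).adicCompletionIntegers ℚ) = a ^ 6 * κ₀ := by
    refine mul_left_cancel₀ (pow_ne_zero 5 h3.ne_zero) ?_
    rw [← hn, hm]; push_cast; ring
  have ha6 : residue ((placeOf 3).adicCompletionIntegers ℚ) a ^ 6 = 1 :=
    pow_six_eq_one residueField_sq_eq_one_placeOf_three ((residue_ne_zero_iff_isUnit a).mpr ha)
  have hres : residue ((placeOf 3).adicCompletionIntegers ℚ) (m : (placeOf 3).adicCompletionIntegers ℚ) =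
      residue ((placeOf 3).adicCompletionIntegers ℚ) κ₀ := by
    rw [hmO, map_mul, map_pow, ha6, one_mul]
  rw [hdiv, ← residue_intCast_eq_one_iff, hres]
  constructor
  · rintro ⟨κ, hκ, hκ1⟩
    have hκκ : κ = κ₀ := mul_left_cancel₀ (pow_ne_zero 5 h3.ne_zero) (hκ.symm.trans hκ₀)
    rw [← hκκ, hκ1]
  · exact fun h1 ↦ ⟨κ₀, hκ₀, h1⟩

/-- **`v₃ c₆ = 5` on the Kodaira-`IV` rows with `v₃(Δ_min) = 6`** (the Kraus / Papadopoulos signature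
`(v₃c₄, v₃c₆, v₃Δ) = (3, 5, 6)`, middle entry), so that `c₆ / 3⁵` above IS the `3`-free part of `c₆`.
[cite: Kraus1990, Théorème (p = 3)] [cite: Papadopoulos1993, Table (p = 3)] -/
theorem padicValInt_c₆_eq_five_of_kodairaIV (hK : W.kodairaSymbolAt (placeOf 3) = .IV)
    (hv : padicValInt 3 W.minimalDiscriminantInt = 6) : padicValInt 3 (integralModelInt W).c₆ = 5 := by
  obtain ⟨-, h3⟩ := isUnit_two_and_irreducible_three_placeOf_three
  have h3p : Prime (3 : (placeOf 3).adicCompletionIntegers ℚ) := h3.prime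
  haveI : PerfectField (ResidueField ((placeOf 3).adicCompletionIntegers ℚ)) := PerfectField.ofFinite
  have hI : (W.localMinimalIntegralModel (placeOf 3)).kodairaSymbolOfMinimal = .IV := by
    rw [← kodairaSymbolAt_def]; exact hK
  have h6 : (3 : (placeOf 3).adicCompletionIntegers ℚ) ^ 6 ∣ (W.localMinimalIntegralModel (placeOf 3)).Δ :=
    (three_pow_dvd_localMinimalIntegralModel_Δ_iff W 6).mpr hv.ge
  obtain ⟨κ₀, hκ₀, hκ₀3⟩ := exists_c₆_eq_pow_five_mul_of_kodairaSymbolOfMinimal_eq_IV h3 _ hI h6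
  obtain ⟨a, ha, hc₆, -⟩ := exists_isUnit_c₆_Δ_eq_mul_localMinimalIntegralModel W
  have hn : (((integralModelInt W).c₆ : ℤ) : (placeOf 3).adicCompletionIntegers ℚ) =
      3 ^ 5 * (a ^ 6 * κ₀) := by
    rw [hc₆, hκ₀]; ring
  obtain ⟨m, hm⟩ : (3 : ℤ) ^ 5 ∣ (integralModelInt W).c₆ := (three_pow_dvd_intCast_iff 5 _).mp ⟨_, hn⟩
  have hmO : ((m : ℤ) : (placeOf 3).adicCompletionIntegers ℚ) = a ^ 6 * κ₀ := by
    refine mul_left_cancel₀ (pow_ne_zero 5 h3.ne_zero) ?_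
    rw [← hn, hm]; push_cast; ring
  refine padicValInt_three_eq_of_eq_pow_mul 5 hm fun h3m ↦ hκ₀3 ?_
  have h' : (3 : (placeOf 3).adicCompletionIntegers ℚ) ∣ a ^ 6 * κ₀ := by
    rw [← hmO, ← pow_one (3 : (placeOf 3).adicCompletionIntegers ℚ)]
    exact (three_pow_dvd_intCast_iff 1 m).mpr (by simpa using h3m)
  rcases h3p.dvd_or_dvd h' with h'' | h''
  · exact absurd (isUnit_of_dvd_unit (h3p.dvd_of_dvd_pow h'') ha) h3p.not_unit
  · exact h''

/-- The local alternative on the Tate model, type `IV*` (`c_v = 3 ⟺ c₆(I) = 3⁶κ`, `Δ(I) = 3¹⁰μ`,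
`(κμ)‾ = 1`), at the place `(3)` of `ℚ`, in the `ℤ₃`-currency. [cite: SilvermanATAEC1994, IV.9.4 Step 8 with Rem. IV.9.3] -/
theorem localTamagawaNumber_three_eq_three_iff_local_IVstar
    (hK : W.kodairaSymbolAt (placeOf 3) = .IVstar) (hv : padicValInt 3 W.minimalDiscriminantInt = 10) :
    (W.baseChange ℚ_[3]).localTamagawaNumber ℤ_[3] = 3 ↔
      ∃ κ μ : (placeOf 3).adicCompletionIntegers ℚ,
        (W.localMinimalIntegralModel (placeOf 3)).c₆ = 3 ^ 6 * κ ∧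
        (W.localMinimalIntegralModel (placeOf 3)).Δ = 3 ^ 10 * μ ∧
        residue ((placeOf 3).adicCompletionIntegers ℚ) (κ * μ) = 1 := by
  obtain ⟨h2, h3⟩ := isUnit_two_and_irreducible_three_placeOf_three
  haveI : PerfectField (ResidueField ((placeOf 3).adicCompletionIntegers ℚ)) := PerfectField.ofFinite
  haveI : HenselianLocalRing ((placeOf 3).adicCompletionIntegers ℚ) := inferInstance
  have hI : (W.localMinimalIntegralModel (placeOf 3)).kodairaSymbolOfMinimal = .IVstar := by
    rw [← kodairaSymbolAt_def]; exact hK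
  have h10 : (3 : (placeOf 3).adicCompletionIntegers ℚ) ^ 10 ∣ (W.localMinimalIntegralModel (placeOf 3)).Δ :=
    (three_pow_dvd_localMinimalIntegralModel_Δ_iff W 10).mpr hv.ge
  have h11 : ¬ (3 : (placeOf 3).adicCompletionIntegers ℚ) ^ 11 ∣ (W.localMinimalIntegralModel (placeOf 3)).Δ := by
    rw [three_pow_dvd_localMinimalIntegralModel_Δ_iff W 11, hv]; norm_num
  rw [localTamagawaNumber_padic_eq_placeOf W 3]
  have key : ∀ (M : WeierstrassCurve ((placeOf 3).adicCompletion ℚ))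
      [M.IsMinimal ((placeOf 3).adicCompletionIntegers ℚ)],
      (M.integralModel ((placeOf 3).adicCompletionIntegers ℚ)).kodairaSymbolOfMinimal = .IVstar →
      (3 : (placeOf 3).adicCompletionIntegers ℚ) ^ 10 ∣
        (M.integralModel ((placeOf 3).adicCompletionIntegers ℚ)).Δ →
      ¬ (3 : (placeOf 3).adicCompletionIntegers ℚ) ^ 11 ∣
        (M.integralModel ((placeOf 3).adicCompletionIntegers ℚ)).Δ →
      ((M.goodReductionSubgroup ((placeOf 3).adicCompletionIntegers ℚ)).index = 3 ↔
        ∃ κ μ : (placeOf 3).adicCompletionIntegers ℚ,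
          (M.integralModel ((placeOf 3).adicCompletionIntegers ℚ)).c₆ = 3 ^ 6 * κ ∧
          (M.integralModel ((placeOf 3).adicCompletionIntegers ℚ)).Δ = 3 ^ 10 * μ ∧
            residue ((placeOf 3).adicCompletionIntegers ℚ) (κ * μ) = 1) := by
    intro M _ hM h10M h11M
    obtain ⟨I, rfl⟩ : ∃ I : WeierstrassCurve ((placeOf 3).adicCompletionIntegers ℚ),
        M = I.baseChange ((placeOf 3).adicCompletion ℚ) := WeierstrassCurve.IsIntegral.integral
    rw [integralModel_baseChange_eq] at hM h10M h11M ⊢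
    rw [goodReductionSubgroup_baseChange_eq]
    exact index_eq_three_iff_of_kodairaSymbolOfMinimal_eq_IVstar h3 h2
      residueField_sq_eq_one_placeOf_three I hM h10M h11M
  exact key (W.localMinimalModel (placeOf 3)) hI h10 h11

/-- **LAW L-c3, type `IV*`.** For `W/ℚ` globally minimal of Kodaira type `IV*` at `3` with `v₃(Δ_min) = 10`
(the cyclic rows with `v = 10`): **`c₃ = 3 ⟺ (Δ_min / 3¹⁰) · (c₆(W_ℤ) / 3⁶) ≡ 1 (mod 3)`** (on the route's
principal-series rows `Δ_min/3¹⁰ ≡ 1`, so this reads `c₆/3⁶ ≡ 1`; on the SCu rows the sign flips).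
[cite: SilvermanATAEC1994, IV.9.4 Step 8 (PDF p. 346) with Rem. IV.9.3] [cite: Papadopoulos1993, Table (p = 3)] -/
theorem localTamagawaNumber_three_eq_three_iff_of_kodairaIVstar
    (hK : W.kodairaSymbolAt (placeOf 3) = .IVstar) (hv : padicValInt 3 W.minimalDiscriminantInt = 10) :
    (W.baseChange ℚ_[3]).localTamagawaNumber ℤ_[3] = 3 ↔
      W.minimalDiscriminantInt / 3 ^ 10 * ((integralModelInt W).c₆ / 3 ^ 6) % 3 = 1 := by
  obtain ⟨-, h3⟩ := isUnit_two_and_irreducible_three_placeOf_three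
  have h3p : Prime (3 : (placeOf 3).adicCompletionIntegers ℚ) := h3.prime
  haveI : PerfectField (ResidueField ((placeOf 3).adicCompletionIntegers ℚ)) := PerfectField.ofFinite
  have hI : (W.localMinimalIntegralModel (placeOf 3)).kodairaSymbolOfMinimal = .IVstar := by
    rw [← kodairaSymbolAt_def]; exact hK
  have h10 : (3 : (placeOf 3).adicCompletionIntegers ℚ) ^ 10 ∣ (W.localMinimalIntegralModel (placeOf 3)).Δ :=
    (three_pow_dvd_localMinimalIntegralModel_Δ_iff W 10).mpr hv.ge
  have h11 : ¬ (3 : (placeOf 3).adicCompletionIntegers ℚ) ^ 11 ∣ (W.localMinimalIntegralModel (placeOf 3)).Δ := by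
    rw [three_pow_dvd_localMinimalIntegralModel_Δ_iff W 11, hv]; norm_num
  rw [localTamagawaNumber_three_eq_three_iff_local_IVstar W hK hv]
  obtain ⟨κ₀, μ₀, hκ₀, hμ₀, hκ₀3, hμ₀3⟩ :=
    exists_c₆_Δ_eq_pow_mul_of_kodairaSymbolOfMinimal_eq_IVstar h3 _ hI h10 h11
  obtain ⟨a, ha, hc₆, hΔ⟩ := exists_isUnit_c₆_Δ_eq_mul_localMinimalIntegralModel W
  have hn : (((integralModelInt W).c₆ : ℤ) : (placeOf 3).adicCompletionIntegers ℚ) =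
      3 ^ 6 * (a ^ 6 * κ₀) := by rw [hc₆, hκ₀]; ring
  have hd : ((W.minimalDiscriminantInt : ℤ) : (placeOf 3).adicCompletionIntegers ℚ) =
      3 ^ 10 * (a ^ 12 * μ₀) := by rw [hΔ, hμ₀]; ring
  obtain ⟨m, hm⟩ : (3 : ℤ) ^ 6 ∣ (integralModelInt W).c₆ := (three_pow_dvd_intCast_iff 6 _).mp ⟨_, hn⟩
  obtain ⟨d, hdd⟩ : (3 : ℤ) ^ 10 ∣ W.minimalDiscriminantInt := (three_pow_dvd_intCast_iff 10 _).mp ⟨_, hd⟩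
  have hdivm : (integralModelInt W).c₆ / 3 ^ 6 = m := by
    rw [hm, Int.mul_ediv_cancel_left _ (pow_ne_zero 6 (by norm_num))]
  have hdivd : W.minimalDiscriminantInt / 3 ^ 10 = d := by
    rw [hdd, Int.mul_ediv_cancel_left _ (pow_ne_zero 10 (by norm_num))]
  have hmO : ((m : ℤ) : (placeOf 3).adicCompletionIntegers ℚ) = a ^ 6 * κ₀ := by
    refine mul_left_cancel₀ (pow_ne_zero 6 h3.ne_zero) ?_
    rw [← hn, hm]; push_cast; ring
  have hdO : ((d : ℤ) : (placeOf 3).adicCompletionIntegers ℚ) = a ^ 12 * μ₀ := by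
    refine mul_left_cancel₀ (pow_ne_zero 10 h3.ne_zero) ?_
    rw [← hd, hdd]; push_cast; ring
  have ha6 : residue ((placeOf 3).adicCompletionIntegers ℚ) a ^ 6 = 1 :=
    pow_six_eq_one residueField_sq_eq_one_placeOf_three ((residue_ne_zero_iff_isUnit a).mpr ha)
  have hres : residue ((placeOf 3).adicCompletionIntegers ℚ)
      (((d * m : ℤ) : ℤ) : (placeOf 3).adicCompletionIntegers ℚ) =
      residue ((placeOf 3).adicCompletionIntegers ℚ) (κ₀ * μ₀) := by
    rw [Int.cast_mul, hmO, hdO]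
    simp only [map_mul, map_pow]
    linear_combination (residue ((placeOf 3).adicCompletionIntegers ℚ) a ^ 12 + residue _ a ^ 6 + 1) *
      residue ((placeOf 3).adicCompletionIntegers ℚ) κ₀ * residue _ μ₀ * ha6
  rw [hdivm, hdivd, ← residue_intCast_eq_one_iff, hres]
  constructor
  · rintro ⟨κ, μ, hκ, hμ, h1⟩
    have hκκ : κ = κ₀ := mul_left_cancel₀ (pow_ne_zero 6 h3.ne_zero) (hκ.symm.trans hκ₀)
    have hμμ : μ = μ₀ := mul_left_cancel₀ (pow_ne_zero 10 h3.ne_zero) (hμ.symm.trans hμ₀)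
    rw [← hκκ, ← hμμ, h1]
  · exact fun h1 ↦ ⟨κ₀, μ₀, hκ₀, hμ₀, h1⟩

/-- **`v₃ c₆ = 6` on the Kodaira-`IV*` rows with `v₃(Δ_min) = 10`** (signature `(4, 6, 10)`).
[cite: Kraus1990, Théorème (p = 3)] [cite: Papadopoulos1993, Table (p = 3)] -/
theorem padicValInt_c₆_eq_six_of_kodairaIVstar (hK : W.kodairaSymbolAt (placeOf 3) = .IVstar)
    (hv : padicValInt 3 W.minimalDiscriminantInt = 10) : padicValInt 3 (integralModelInt W).c₆ = 6 := by
  obtain ⟨-, h3⟩ := isUnit_two_and_irreducible_three_placeOf_three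
  have h3p : Prime (3 : (placeOf 3).adicCompletionIntegers ℚ) := h3.prime
  haveI : PerfectField (ResidueField ((placeOf 3).adicCompletionIntegers ℚ)) := PerfectField.ofFinite
  have hI : (W.localMinimalIntegralModel (placeOf 3)).kodairaSymbolOfMinimal = .IVstar := by
    rw [← kodairaSymbolAt_def]; exact hK
  have h10 : (3 : (placeOf 3).adicCompletionIntegers ℚ) ^ 10 ∣ (W.localMinimalIntegralModel (placeOf 3)).Δ :=
    (three_pow_dvd_localMinimalIntegralModel_Δ_iff W 10).mpr hv.ge
  have h11 : ¬ (3 : (placeOf 3).adicCompletionIntegers ℚ) ^ 11 ∣ (W.localMinimalIntegralModel (placeOf 3)).Δ := by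
    rw [three_pow_dvd_localMinimalIntegralModel_Δ_iff W 11, hv]; norm_num
  obtain ⟨κ₀, μ₀, hκ₀, -, hκ₀3, -⟩ :=
    exists_c₆_Δ_eq_pow_mul_of_kodairaSymbolOfMinimal_eq_IVstar h3 _ hI h10 h11
  obtain ⟨a, ha, hc₆, -⟩ := exists_isUnit_c₆_Δ_eq_mul_localMinimalIntegralModel W
  have hn : (((integralModelInt W).c₆ : ℤ) : (placeOf 3).adicCompletionIntegers ℚ) =
      3 ^ 6 * (a ^ 6 * κ₀) := by rw [hc₆, hκ₀]; ring
  obtain ⟨m, hm⟩ : (3 : ℤ) ^ 6 ∣ (integralModelInt W).c₆ := (three_pow_dvd_intCast_iff 6 _).mp ⟨_, hn⟩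
  have hmO : ((m : ℤ) : (placeOf 3).adicCompletionIntegers ℚ) = a ^ 6 * κ₀ := by
    refine mul_left_cancel₀ (pow_ne_zero 6 h3.ne_zero) ?_
    rw [← hn, hm]; push_cast; ring
  refine padicValInt_three_eq_of_eq_pow_mul 6 hm fun h3m ↦ hκ₀3 ?_
  have h' : (3 : (placeOf 3).adicCompletionIntegers ℚ) ∣ a ^ 6 * κ₀ := by
    rw [← hmO, ← pow_one (3 : (placeOf 3).adicCompletionIntegers ℚ)]
    exact (three_pow_dvd_intCast_iff 1 m).mpr (by simpa using h3m)
  rcases h3p.dvd_or_dvd h' with h'' | h''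
  · exact absurd (isUnit_of_dvd_unit (h3p.dvd_of_dvd_pow h'') ha) h3p.not_unit
  · exact h''

end Law

/-! ### §5 The cyclic wild cell and the principal-series rows of K1/K2 -/

section Rows

variable (W : WeierstrassCurve ℚ) [W.IsElliptic] [W.IsGloballyMinimal]

/-- **LAW L-c3 on the rows `v₃(Δ_min) = 6` of the wild cell** (`ClassO6 W 3`; then Kodaira `IV`):
`c₃ = 3 ⟺ c₆ / 3⁵ ≡ 1 (mod 3)`. [cite: SilvermanATAEC1994, IV.9.4 Step 5] [cite: Papadopoulos1993, Table (p = 3)] -/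
theorem localTamagawaNumber_three_eq_three_iff_of_six (hO6 : ClassO6 W 3)
    (h6 : padicValInt 3 W.minimalDiscriminantInt = 6) :
    (W.baseChange ℚ_[3]).localTamagawaNumber ℤ_[3] = 3 ↔ (integralModelInt W).c₆ / 3 ^ 5 % 3 = 1 := by
  obtain ⟨-, hadd, hW⟩ := hO6
  rcases PSKodairaDictionary.kodairaSymbolAt_of_mod_four_eq_two W hadd hW (by omega) with ⟨hK, -⟩ | ⟨-, h⟩
  · exact localTamagawaNumber_three_eq_three_iff_of_kodairaIV W hK h6
  · omega

/-- **LAW L-c3 on the rows `v₃(Δ_min) = 10` of the wild cell** (then Kodaira `IV*`):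
`c₃ = 3 ⟺ (Δ_min / 3¹⁰)·(c₆ / 3⁶) ≡ 1 (mod 3)`. [cite: SilvermanATAEC1994, IV.9.4 Step 8] [cite: Papadopoulos1993, Table (p = 3)] -/
theorem localTamagawaNumber_three_eq_three_iff_of_ten (hO6 : ClassO6 W 3)
    (h10 : padicValInt 3 W.minimalDiscriminantInt = 10) :
    (W.baseChange ℚ_[3]).localTamagawaNumber ℤ_[3] = 3 ↔
      W.minimalDiscriminantInt / 3 ^ 10 * ((integralModelInt W).c₆ / 3 ^ 6) % 3 = 1 := by
  obtain ⟨-, hadd, hW⟩ := hO6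
  rcases PSKodairaDictionary.kodairaSymbolAt_of_mod_four_eq_two W hadd hW (by omega) with ⟨-, h⟩ | ⟨hK, -⟩
  · omega
  · exact localTamagawaNumber_three_eq_three_iff_of_kodairaIVstar W hK h10

/-- **LAW L-c3 on the PRINCIPAL-SERIES rows of route `CyclotomicUntwist`** (the binders of K1/K2:
`ClassO6 W 3`, `v₃(Δ_min)` even, `Δ_min / 3^v ≡ 1 (mod 3)`): **`3 ∣ c₃ ⟺ v₃(Δ_min) ≡ 2 (mod 4) ∧
c₆ / 3^{v₃ c₆} ≡ 1 (mod 3)`** — the `ℓ = 3` factor of the K1-stub-2 predicate `3 ∣ ∏ c_ℓ`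
(`PSTamagawaProduct.three_dvd_tamagawaProduct_iff_of_even`) in Kraus-invariant, census-decidable currency.
[cite: SilvermanATAEC1994, IV.9.4 Steps 3, 5, 8, 10] [cite: Kraus1990, Théorème (p = 3)] -/
theorem three_dvd_localTamagawaNumber_three_iff_of_psRow (hO6 : ClassO6 W 3)
    (hev : Even (padicValInt 3 W.minimalDiscriminantInt))
    (hsq : W.minimalDiscriminantInt / 3 ^ padicValInt 3 W.minimalDiscriminantInt % 3 = 1) :
    3 ∣ (W.baseChange ℚ_[3]).localTamagawaNumber ℤ_[3] ↔
      padicValInt 3 W.minimalDiscriminantInt % 4 = 2 ∧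
        (integralModelInt W).c₆ / 3 ^ padicValInt 3 (integralModelInt W).c₆ % 3 = 1 := by
  obtain ⟨-, hadd, hW⟩ := hO6
  have h2 : padicValInt 3 W.minimalDiscriminantInt % 2 = 0 := Nat.even_iff.mp hev
  by_cases h4 : padicValInt 3 W.minimalDiscriminantInt % 4 = 2
  · have h13 := PSKodairaDictionary.localTamagawaNumber_three_of_mod_four_eq_two W hadd hW h4
    have hdvd : 3 ∣ (W.baseChange ℚ_[3]).localTamagawaNumber ℤ_[3] ↔
        (W.baseChange ℚ_[3]).localTamagawaNumber ℤ_[3] = 3 := by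
      rcases h13 with h | h <;> rw [h] <;> norm_num
    rw [hdvd]
    rcases PSKodairaDictionary.kodairaSymbolAt_of_mod_four_eq_two W hadd hW h4 with ⟨hK, h6⟩ | ⟨hK, h10⟩
    · rw [localTamagawaNumber_three_eq_three_iff_of_kodairaIV W hK h6,
        padicValInt_c₆_eq_five_of_kodairaIV W hK h6]
      exact ⟨fun h ↦ ⟨h4, h⟩, fun h ↦ h.2⟩
    · rw [localTamagawaNumber_three_eq_three_iff_of_kodairaIVstar W hK h10,
        padicValInt_c₆_eq_six_of_kodairaIVstar W hK h10]
      rw [h10] at hsq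
      rw [Int.mul_emod, hsq, one_mul, Int.emod_emod_of_dvd _ (dvd_refl _)]
      exact ⟨fun h ↦ ⟨h4, h⟩, fun h ↦ h.2⟩
  · have h0 : 4 ∣ padicValInt 3 W.minimalDiscriminantInt := by omega
    rw [PSKodairaDictionary.localTamagawaNumber_three_eq_one_of_four_dvd W hadd hW h0]
    simp only [h4, false_and, iff_false]
    norm_num

end Rows

end Summit.BirchSwinnertonDyer.BirchSwinnertonDyer.Theorems.PSTamagawaThree
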